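import Mathlib
import Summits.NavierStokesRegularity.NavierStokesRegularity.Theorems.LerayQuarterDissipationFiniteDissipationLiouvilleVorticityAmplitude
import HarnessLib

/-!
# Crux `FiniteDissipationLiouville` (stmt-NavierStokesRegularity-22144): the `C`-priced stretching
# bound against the squared cutoff with a free Young weight, and the enstrophy budget under a
# four-term stretching bound (joint velocity / vorticity-amplitude region, file 1/2)

Theorems file of route `LerayQuarterDissipation` (lead prover g15; `--supports` the crux; portrait
fact for the registered stub `stub_envelopeCriticalLiouville` of skeleton `Lines/birth.lean`; sequel
of `…VorticityAmplitude`). Navier–Stokes regularity is NOT proved by anything here; no summit is.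

`𝒟_{C,K}`: Type-I ancient mild fields `V` (KNSS gauge, `IsTypeIAncientMild C V`: in particular
`√(−t)‖V(t,x)‖ ≤ C`) with the quarter-rate law `∫‖DV(t)‖² ≤ K/√(−t)`; `C_ω` a bound of the
scale-invariant vorticity amplitude `(−t)‖curl V(t,x)‖`. The tree holds the two "pure" rungs
`C < 1 ⇒ V ≡ 0` (`…SimilarityEnstrophy.typeI_ancient_eq_zero_of_rate_lt_one`, stretching priced by
`‖U‖ ≤ C` and absorbed by the dissipation) and `C_ω < √3/4 ⇒ V ≡ 0` (`…VorticityAmplitude`,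
stretching priced by `‖Ω‖ ≤ C_ω`, dissipation discarded). Splitting the stretching term
`2∫φ²⟪DUΩ,Ω⟫ = λ·(…) + (1−λ)·(…)` and pricing the first part by `C` with the Young weight `μ = 1/λ`
(so that it consumes exactly the dissipation `2∫φ²|∇Ω|²_F`) and the second by `C_ω` gives the
budget `Z_R' ≤ −½Z_R + (λ²C²/2 + (1−λ)(2/√3)C_ω)·m + LM/R` and hence:

* `two_mul_integral_sqCutoff_stretching_le_typeI` — the `C`-priced stretching bound against the
  SQUARED cutoff with a free Young weight:
  `2∫φ_R²⟪DUΩ,Ω⟫ ≤ 2μ∫φ_R²|∇Ω|²_F + (C²/2μ)∫φ_R²‖Ω‖² + (4Cc₁/R)∫_{B̄_{2R}}‖Ω‖²`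
  (`integral_mul_inner_stretching_eq`: move the derivative onto `Ω`, `div Ω = 0`);
* `integral_sq_norm_lerayVorticity_le_of_forall_le'` — the budget under a four-term stretching bound
  `2·str_R ≤ 2D_R + aZ_R + bZ_∞ + (c/R)I_{2R}`: a uniform bound `Z_∞ ≤ m` improves to `2(a+b)m`;
* (file 2/2 `…VorticityAmplitudeJoint`: `λ²C² + (1−λ)(4/√3)C_ω < 1` for some `λ ∈ (0,1]` forces
  `V ≡ 0`; the corner `C ≤ 1`, `C_ω < √3/2`.)

HONEST FRAMING. Explicit necessary conditions on the HYPOTHETICAL singular profile in the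
`(C, C_ω)` plane; unoptimised beyond the two pricings; nothing removed from the catalogued DSS wall
(`TypeIDSSLiouville`, NECESSARY for the crux); nothing here bears on Navier–Stokes regularity or
blow-up.

References: Koch–Nadirashvili–Seregin–Šverák, Acta Math. 203 (2009) §4; folklore energy method.
-/

noncomputable section

set_option linter.dupNamespace false

namespace Summit.NavierStokesRegularity.NavierStokesRegularity.Theorems.FiniteDissipationLiouville.VorticityAmplitude

open MeasureTheory Set Filter Topology Metric InnerProductSpace Function Real
open scoped RealInnerProductSpace ContDiff ENNReal Laplacian
open Literature.Analysis Literature.Analysis.FluidPDE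
open Summit.NavierStokesRegularity.NavierStokesRegularity.Theorems
open Summit.NavierStokesRegularity.NavierStokesRegularity.Theorems.GaussianGap
open Summit.NavierStokesRegularity.NavierStokesRegularity.Theorems.SimilarityEnstrophy
open Summit.NavierStokesRegularity.NavierStokesRegularity.Theorems.SmallDissipationGap

variable {C : ℝ} {V : ℝ → (EuclideanSpace ℝ (Fin 3)) → (EuclideanSpace ℝ (Fin 3))}

/-! ### The `C`-priced stretching bound against the squared cutoff, free Young weight -/

section Stretching

/-- **The stretching term against `φ_R²`, priced by the Type-I constant with a free Young weight.**
With `‖U‖ ≤ C` and `μ > 0`: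
`2∫φ_R²⟪DU Ω, Ω⟫ ≤ 2μ∫φ_R²|∇Ω|²_F + (C²/(2μ))∫φ_R²‖Ω‖² + (4Cc₁/R)∫_{B̄_{2R}}‖Ω‖²` — move the
derivative onto `Ω` (`integral_mul_inner_stretching_eq`, `div Ω = 0`),
`|⟪U, DΩ Ω⟫| ≤ C‖DΩ‖‖Ω‖ ≤ μ|DΩ|²_F + (C²/4μ)‖Ω‖²`, and the collar `‖D(φ_R²)‖ ≤ 2c₁/R`. [folklore] -/
theorem two_mul_integral_sqCutoff_stretching_le_typeI (hV : IsTypeIAncientMild C V) {c₁ : ℝ}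
    (hc₁ : ∀ R : ℝ, 0 < R → ∀ y : EuclideanSpace ℝ (Fin 3),
      ‖fderiv ℝ (fun z : EuclideanSpace ℝ (Fin 3) => smoothTransition (2 - ‖z‖ ^ 2 / R ^ 2)) y‖ ≤
        c₁ / R)
    {R : ℝ} (hR : 0 < R) (s : ℝ) {μ : ℝ} (hμ : 0 < μ) :
    2 * (∫ y, smoothTransition (2 - ‖y‖ ^ 2 / R ^ 2) ^ 2 *
        ⟪fderiv ℝ (lerayOrbit V s) y (lerayVorticity V s y), lerayVorticity V s y⟫) ≤
      2 * μ * (∫ y, smoothTransition (2 - ‖y‖ ^ 2 / R ^ 2) ^ 2 *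
          frobeniusNormSq (fderiv ℝ (lerayVorticity V s) y)) +
        (C ^ 2 / (2 * μ)) * (∫ y, smoothTransition (2 - ‖y‖ ^ 2 / R ^ 2) ^ 2 * ‖lerayVorticity V s y‖ ^ 2) +
        4 * C * (c₁ / R) *
          ∫ y in closedBall (0 : EuclideanSpace ℝ (Fin 3)) (2 * R), ‖lerayVorticity V s y‖ ^ 2 := by
  have hC : 0 ≤ C := hV.nonneg
  set φ : EuclideanSpace ℝ (Fin 3) → ℝ := fun z => smoothTransition (2 - ‖z‖ ^ 2 / R ^ 2) ^ 2
    with hφdef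
  set Ω := lerayVorticity V s with hΩdef
  set U := lerayOrbit V s with hUdef
  have hφ1 : ContDiff ℝ 1 φ := contDiff_sqCutoff (n := 1) R
  have hφc : HasCompactSupport φ := hasCompactSupport_sqCutoff hR
  have hφ0 : ∀ y, 0 ≤ φ y := fun y => sqCutoff_nonneg R y
  have hΩ1 : ContDiff ℝ 1 Ω := signedBudget_contDiff_lerayVorticity_slice hV s (n := 1)
  have hU1 : ContDiff ℝ 1 U := mustSqueeze_contDiff_lerayOrbit_slice hV s (n := 1)
  have hUC : ∀ y, ‖U y‖ ≤ C := fun y => norm_lerayOrbit_le_of_typeI hV s y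
  have hdivΩ : VectorCalculus.IsDivFree Ω := fun y =>
    divergence_curl_eq_zero_holds _
      ((contDiff_lerayOrbit_slice_of_typeI hV s (n := (⊤ : ℕ∞)) le_rfl).of_le (by norm_cast)) y
  have hcΩ : Continuous Ω := hΩ1.continuous
  have hcU : Continuous U := hU1.continuous
  have hcDΩ : Continuous (fderiv ℝ Ω) := hΩ1.continuous_fderiv one_ne_zero
  have hcφ : Continuous φ := hφ1.continuous
  have hcDφ : Continuous (fderiv ℝ φ) := hφ1.continuous_fderiv one_ne_zero
  have hcF : Continuous fun y => frobeniusNormSq (fderiv ℝ Ω y) :=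
    continuous_frobeniusNormSq_fderiv_lerayVorticity hV s
  -- move the derivative onto `Ω`
  have hIBP := integral_mul_inner_stretching_eq hφ1 hφc hU1 hΩ1 hdivΩ
  have iF : Integrable fun y => φ y * frobeniusNormSq (fderiv ℝ Ω y) :=
    (hcφ.mul hcF).integrable_of_hasCompactSupport hφc.mul_right
  have iZ : Integrable fun y => φ y * ‖Ω y‖ ^ 2 :=
    (hcφ.mul (hcΩ.norm.pow 2)).integrable_of_hasCompactSupport hφc.mul_right
  have iQ : Integrable fun y => φ y * ⟪U y, fderiv ℝ Ω y (Ω y)⟫ :=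
    (hcφ.mul (hcU.inner (hcDΩ.clm_apply hcΩ))).integrable_of_hasCompactSupport hφc.mul_right
  -- (a) the main term
  have hmain : -(∫ y, φ y * ⟪U y, fderiv ℝ Ω y (Ω y)⟫) ≤
      μ * (∫ y, φ y * frobeniusNormSq (fderiv ℝ Ω y)) + (C ^ 2 / (4 * μ)) * ∫ y, φ y * ‖Ω y‖ ^ 2 := by
    rw [← integral_neg, ← integral_const_mul, ← integral_const_mul,
      ← integral_add (iF.const_mul _) (iZ.const_mul _)]
    refine integral_mono iQ.neg ((iF.const_mul _).add (iZ.const_mul _)) fun y => ?_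
    dsimp only
    have hop := sq_opNorm_le_frobeniusNormSq (fderiv ℝ Ω y)
    set a := ‖fderiv ℝ Ω y‖ with ha
    set b := ‖Ω y‖ with hb
    have h1 : -(φ y * ⟪U y, fderiv ℝ Ω y (Ω y)⟫) ≤ φ y * (C * (a * b)) := by
      rw [← mul_neg]
      refine mul_le_mul_of_nonneg_left ?_ (hφ0 y)
      calc -⟪U y, fderiv ℝ Ω y (Ω y)⟫ ≤ ‖⟪U y, fderiv ℝ Ω y (Ω y)⟫‖ := by
            rw [Real.norm_eq_abs]; exact neg_le_abs _
        _ ≤ ‖U y‖ * ‖fderiv ℝ Ω y (Ω y)‖ := norm_inner_le_norm _ _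
        _ ≤ C * (a * b) :=
            mul_le_mul (hUC y) (ContinuousLinearMap.le_opNorm _ _) (norm_nonneg _) hC
    have h2 : C * (a * b) ≤ μ * a ^ 2 + C ^ 2 / (4 * μ) * b ^ 2 := by
      have e : μ * a ^ 2 + C ^ 2 / (4 * μ) * b ^ 2 - C * (a * b) = (2 * μ * a - C * b) ^ 2 / (4 * μ) := by
        field_simp
        ring
      rw [← sub_nonneg, e]
      positivity
    have h3 : φ y * (C * (a * b)) ≤
        φ y * (μ * frobeniusNormSq (fderiv ℝ Ω y) + C ^ 2 / (4 * μ) * b ^ 2) := by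
      refine mul_le_mul_of_nonneg_left (h2.trans ?_) (hφ0 y)
      have := mul_le_mul_of_nonneg_left hop hμ.le
      linarith
    linarith
  -- (b) the collar term
  have hcollar : |∫ y, fderiv ℝ φ y (Ω y) * ⟪U y, Ω y⟫| ≤
      C * (2 * (c₁ / R)) * ∫ y in closedBall (0 : EuclideanSpace ℝ (Fin 3)) (2 * R), ‖Ω y‖ ^ 2 := by
    refine abs_integral_le_of_weight_sq hcΩ (w := fun y => C * ‖fderiv ℝ φ y‖)
      (continuous_const.mul hcDφ.norm) (fun y hy => ?_) (fun y _ => ?_) (fun y => ?_)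
    · show C * ‖fderiv ℝ φ y‖ = 0
      rw [hφdef, fderiv_sqCutoff_eq_zero hR hy, norm_zero, mul_zero]
    · show C * ‖fderiv ℝ φ y‖ ≤ C * (2 * (c₁ / R))
      exact mul_le_mul_of_nonneg_left (norm_fderiv_sqCutoff_le hc₁ hR y) hC
    · rw [abs_mul]
      have e1 : |fderiv ℝ φ y (Ω y)| ≤ ‖fderiv ℝ φ y‖ * ‖Ω y‖ := by
        rw [← Real.norm_eq_abs]; exact ContinuousLinearMap.le_opNorm _ _
      have e2 : |⟪U y, Ω y⟫| ≤ C * ‖Ω y‖ := by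
        rw [← Real.norm_eq_abs]
        exact (norm_inner_le_norm _ _).trans (mul_le_mul_of_nonneg_right (hUC y) (norm_nonneg _))
      calc |fderiv ℝ φ y (Ω y)| * |⟪U y, Ω y⟫| ≤ (‖fderiv ℝ φ y‖ * ‖Ω y‖) * (C * ‖Ω y‖) :=
            mul_le_mul e1 e2 (abs_nonneg _) (by positivity)
        _ = C * ‖fderiv ℝ φ y‖ * ‖Ω y‖ ^ 2 := by ring
  have hcollar' : -(∫ y, fderiv ℝ φ y (Ω y) * ⟪U y, Ω y⟫) ≤
      C * (2 * (c₁ / R)) * ∫ y in closedBall (0 : EuclideanSpace ℝ (Fin 3)) (2 * R), ‖Ω y‖ ^ 2 :=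
    (neg_le_abs _).trans hcollar
  rw [hIBP]
  have e4 : C ^ 2 / (2 * μ) * (∫ y, φ y * ‖Ω y‖ ^ 2) = 2 * ((C ^ 2 / (4 * μ)) * ∫ y, φ y * ‖Ω y‖ ^ 2) := by
    field_simp
    ring
  rw [e4]
  linarith

end Stretching

/-! ### The budget under a four-term stretching bound -/

section Budget

/-- **One turn of the screw, dissipation used.** Let `V ∈ 𝒟_{C,K}` satisfy, for all `σ` and `R > 0`,
`2∫φ_R²⟪DUΩ,Ω⟫ ≤ 2∫φ_R²|∇Ω|²_F + a Z_R + b Z_∞ + (c/R)∫_{B̄_{2R}}‖Ω‖²` (`a, b, c ≥ 0`), and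
`Z_∞(σ) ≤ m` for all `σ`. Then `Z_∞(s) ≤ 2(a+b)m` for all `s`: the dissipation of the identity
cancels the first term, the rest is as in `integral_sq_norm_lerayVorticity_le_of_forall_le`.
[folklore energy method] -/
theorem integral_sq_norm_lerayVorticity_le_of_forall_le' (hV : IsTypeIAncientMild C V) {K : ℝ}
    (hK : ∀ t : ℝ, t < 0 → ∫⁻ x, ‖fderiv ℝ (V t) x‖ₑ ^ 2 ≤ ENNReal.ofReal (K / Real.sqrt (-t)))
    {a b c : ℝ} (ha : 0 ≤ a) (hb : 0 ≤ b) (hc : 0 ≤ c)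
    (hstr : ∀ σ : ℝ, ∀ R : ℝ, 0 < R →
      2 * (∫ y, smoothTransition (2 - ‖y‖ ^ 2 / R ^ 2) ^ 2 *
        ⟪fderiv ℝ (lerayOrbit V σ) y (lerayVorticity V σ y), lerayVorticity V σ y⟫) ≤
        2 * (∫ y, smoothTransition (2 - ‖y‖ ^ 2 / R ^ 2) ^ 2 *
            frobeniusNormSq (fderiv ℝ (lerayVorticity V σ) y)) +
          a * (∫ y, smoothTransition (2 - ‖y‖ ^ 2 / R ^ 2) ^ 2 * ‖lerayVorticity V σ y‖ ^ 2) +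
          b * (∫ y, ‖lerayVorticity V σ y‖ ^ 2) +
          c / R * ∫ y in closedBall (0 : EuclideanSpace ℝ (Fin 3)) (2 * R), ‖lerayVorticity V σ y‖ ^ 2)
    {m : ℝ} (hm : ∀ s, ∫ y, ‖lerayVorticity V s y‖ ^ 2 ≤ m) (s : ℝ) :
    ∫ y, ‖lerayVorticity V s y‖ ^ 2 ≤ 2 * (a + b) * m := by
  obtain ⟨c₁, hc₁0, hc₁⟩ :=
    exists_norm_fderiv_smoothTransition_cutoff_le (E := (EuclideanSpace ℝ (Fin 3)))
  obtain ⟨c₂, hc₂0, hc₂⟩ :=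
    exists_abs_laplacian_smoothTransition_cutoff_le (E := (EuclideanSpace ℝ (Fin 3)))
  have hC : 0 ≤ C := hV.nonneg
  have hΩi := fun σ => integrable_sq_norm_lerayVorticity hV hK σ
  set M : ℝ := ‖curlCLM‖ ^ 2 * max K 0 with hMdef
  have hM0 : 0 ≤ M := by positivity
  have hm0 : 0 ≤ m := (integral_nonneg fun y => sq_nonneg _).trans (hm s)
  set L : ℝ := 2 * C * c₁ + 2 * c₂ + 6 * c₁ ^ 2 + c with hLdef
  have hL0 : 0 ≤ L := by positivity
  -- Step 1
  have hZ : ∀ R : ℝ, 1 ≤ R → ∀ σ : ℝ,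
      (∫ y, smoothTransition (2 - ‖y‖ ^ 2 / R ^ 2) ^ 2 * ‖lerayVorticity V σ y‖ ^ 2) ≤
        ((a + b) * m + L / R * M) / (1 / 2) := by
    intro R hR1
    have hR : 0 < R := lt_of_lt_of_le one_pos hR1
    have hd : Differentiable ℝ fun σ =>
        ∫ y, smoothTransition (2 - ‖y‖ ^ 2 / R ^ 2) ^ 2 * ‖lerayVorticity V σ y‖ ^ 2 :=
      fun σ => (hasDerivAt_sqCutoffEnstrophy hV hR σ).differentiableAt
    have hle' : ∀ σ, (∫ y, smoothTransition (2 - ‖y‖ ^ 2 / R ^ 2) ^ 2 * ‖lerayVorticity V σ y‖ ^ 2) ≤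
        ∫ y, ‖lerayVorticity V σ y‖ ^ 2 := by
      intro σ
      refine integral_mono_of_nonneg (Eventually.of_forall fun y =>
        mul_nonneg (sq_nonneg _) (sq_nonneg _)) (hΩi σ).1 (Eventually.of_forall fun y => ?_)
      have h1 := sqCutoff_le_one R y
      have h0 : 0 ≤ ‖lerayVorticity V σ y‖ ^ 2 := sq_nonneg _
      nlinarith
    have hle : ∀ σ, (∫ y, smoothTransition (2 - ‖y‖ ^ 2 / R ^ 2) ^ 2 * ‖lerayVorticity V σ y‖ ^ 2) ≤ M :=
      fun σ => (hle' σ).trans (hΩi σ).2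
    have hI : ∀ σ, (∫ y in closedBall (0 : EuclideanSpace ℝ (Fin 3)) (2 * R), ‖lerayVorticity V σ y‖ ^ 2) ≤ M :=
      fun σ => (setIntegral_le_integral (hΩi σ).1 (Eventually.of_forall fun y => sq_nonneg _)).trans (hΩi σ).2
    have hZ' : ∀ σ, deriv (fun σ' =>
        ∫ y, smoothTransition (2 - ‖y‖ ^ 2 / R ^ 2) ^ 2 * ‖lerayVorticity V σ' y‖ ^ 2) σ ≤
        -(1 / 2) * (∫ y, smoothTransition (2 - ‖y‖ ^ 2 / R ^ 2) ^ 2 * ‖lerayVorticity V σ y‖ ^ 2) +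
          ((a + b) * m + L / R * M) := by
      intro σ
      rw [deriv_sqCutoffEnstrophy_eq hV hR σ]
      set φ : (EuclideanSpace ℝ (Fin 3)) → ℝ := fun z => smoothTransition (2 - ‖z‖ ^ 2 / R ^ 2) with hφdef
      set Ω := lerayVorticity V σ with hΩdef
      set U := lerayOrbit V σ with hUdef
      set I : ℝ := ∫ y in closedBall (0 : (EuclideanSpace ℝ (Fin 3))) (2 * R), ‖Ω y‖ ^ 2 with hIdef
      set Z : ℝ := ∫ y, φ y ^ 2 * ‖Ω y‖ ^ 2 with hZdef
      have hI0 : 0 ≤ I := integral_nonneg fun y => sq_nonneg _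
      have hIM : I ≤ M := hI σ
      have hZ0 : 0 ≤ Z := integral_nonneg fun y => mul_nonneg (sq_nonneg _) (sq_nonneg _)
      have hZm : Z ≤ m := (hle' σ).trans (hm σ)
      have hΩ1 : ContDiff ℝ 1 Ω := signedBudget_contDiff_lerayVorticity_slice hV σ (n := 1)
      have hcΩ : Continuous Ω := hΩ1.continuous
      have hUC : ∀ y, ‖U y‖ ≤ C := fun y => norm_lerayOrbit_le_of_typeI hV σ y
      have hw1 : ContDiff ℝ 1 fun z : (EuclideanSpace ℝ (Fin 3)) => φ z ^ 2 := contDiff_sqCutoff (n := 1) R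
      have hw2 : ContDiff ℝ 2 fun z : (EuclideanSpace ℝ (Fin 3)) => φ z ^ 2 := contDiff_sqCutoff (n := 2) R
      have hcDw : Continuous (fderiv ℝ fun z : (EuclideanSpace ℝ (Fin 3)) => φ z ^ 2) :=
        hw1.continuous_fderiv one_ne_zero
      have hDrift : (∫ y, fderiv ℝ (fun z : (EuclideanSpace ℝ (Fin 3)) => φ z ^ 2) y y * ‖Ω y‖ ^ 2) ≤ 0 :=
        integral_nonpos fun y => mul_nonpos_iff.2 (Or.inr ⟨fderiv_sqCutoff_self_nonpos R y, sq_nonneg _⟩)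
      have hT : |∫ y, fderiv ℝ (fun z : (EuclideanSpace ℝ (Fin 3)) => φ z ^ 2) y (U y) * ‖Ω y‖ ^ 2| ≤
          C * (2 * (c₁ / R)) * I := by
        refine abs_integral_le_of_weight_sq hcΩ (w := fun y => C * ‖fderiv ℝ (fun z : (EuclideanSpace ℝ (Fin 3)) => φ z ^ 2) y‖)
          (continuous_const.mul hcDw.norm) (fun y hy => ?_) (fun y _ => ?_) (fun y => ?_)
        · show C * ‖fderiv ℝ (fun z : (EuclideanSpace ℝ (Fin 3)) => φ z ^ 2) y‖ = 0
          rw [hφdef, fderiv_sqCutoff_eq_zero hR hy, norm_zero, mul_zero]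
        · exact mul_le_mul_of_nonneg_left (norm_fderiv_sqCutoff_le hc₁ hR y) hC
        · rw [abs_mul, abs_of_nonneg (sq_nonneg ‖Ω y‖)]
          have e1 : |fderiv ℝ (fun z : (EuclideanSpace ℝ (Fin 3)) => φ z ^ 2) y (U y)| ≤
              ‖fderiv ℝ (fun z : (EuclideanSpace ℝ (Fin 3)) => φ z ^ 2) y‖ * C := by
            rw [← Real.norm_eq_abs]
            exact (ContinuousLinearMap.le_opNorm _ _).trans
              (mul_le_mul_of_nonneg_left (hUC y) (norm_nonneg _))
          calc |fderiv ℝ (fun z : (EuclideanSpace ℝ (Fin 3)) => φ z ^ 2) y (U y)| * ‖Ω y‖ ^ 2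
              ≤ (‖fderiv ℝ (fun z : (EuclideanSpace ℝ (Fin 3)) => φ z ^ 2) y‖ * C) * ‖Ω y‖ ^ 2 :=
                mul_le_mul_of_nonneg_right e1 (sq_nonneg _)
            _ = C * ‖fderiv ℝ (fun z : (EuclideanSpace ℝ (Fin 3)) => φ z ^ 2) y‖ * ‖Ω y‖ ^ 2 := by ring
      have hVisc : |∫ y, ‖Ω y‖ ^ 2 * (Δ (fun z : (EuclideanSpace ℝ (Fin 3)) => φ z ^ 2)) y| ≤
          (2 * (c₂ / R ^ 2) + 6 * (c₁ / R) ^ 2) * I := by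
        refine abs_integral_le_of_weight_sq hcΩ (w := fun y => |(Δ (fun z : (EuclideanSpace ℝ (Fin 3)) => φ z ^ 2)) y|)
          (continuous_laplacian hw2).abs (fun y hy => ?_) (fun y _ => ?_) (fun y => ?_)
        · show |(Δ (fun z : (EuclideanSpace ℝ (Fin 3)) => φ z ^ 2)) y| = 0
          rw [hφdef, laplacian_sqCutoff_eq_zero hR hy, abs_zero]
        · exact abs_laplacian_sqCutoff_le hc₁ hc₂ hR y
        · rw [abs_mul, abs_of_nonneg (sq_nonneg ‖Ω y‖), mul_comm]
      -- stretching by hypothesis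
      have hS := hstr σ R hR
      have hSa : a * Z ≤ a * m := mul_le_mul_of_nonneg_left hZm ha
      have hSb : b * ∫ y, ‖lerayVorticity V σ y‖ ^ 2 ≤ b * m := mul_le_mul_of_nonneg_left (hm σ) hb
      have hSc : c / R * I ≤ c / R * M := mul_le_mul_of_nonneg_left hIM (div_nonneg hc hR.le)
      -- absorption
      have hT' := (le_abs_self _).trans hT
      have hVisc' := (le_abs_self _).trans hVisc
      have hR2 : 1 / R ^ 2 ≤ 1 / R := by
        rw [div_le_div_iff₀ (by positivity) hR]
        nlinarith
      have hc₂R : c₂ / R ^ 2 ≤ c₂ / R := by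
        have := mul_le_mul_of_nonneg_left hR2 hc₂0
        simpa only [mul_one_div] using this
      have hc₁R : (c₁ / R) ^ 2 ≤ c₁ ^ 2 / R := by
        rw [div_pow]
        have := mul_le_mul_of_nonneg_left hR2 (sq_nonneg c₁)
        simpa only [mul_one_div] using this
      have a1 : C * (2 * (c₁ / R)) * I ≤ C * (2 * (c₁ / R)) * M :=
        mul_le_mul_of_nonneg_left hIM (by positivity)
      have a2 : (2 * (c₂ / R ^ 2) + 6 * (c₁ / R) ^ 2) * I ≤ (2 * (c₂ / R) + 6 * (c₁ ^ 2 / R)) * M :=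
        (mul_le_mul_of_nonneg_right (by linarith [hc₂R, hc₁R]) hI0).trans
          (mul_le_mul_of_nonneg_left hIM (by positivity))
      have e : L / R * M =
          C * (2 * (c₁ / R)) * M + (2 * (c₂ / R) + 6 * (c₁ ^ 2 / R)) * M + c / R * M := by
        rw [hLdef]; field_simp; ring
      rw [e]
      linarith [hDrift, hT', hVisc', hS, hSa, hSb, hSc, a1, a2]
    exact le_div_of_deriv_le_neg_mul_add hd ⟨M, hle⟩ (by norm_num : (0:ℝ) < 1 / 2) hZ'
  -- Step 2: balls
  have hcΩ : Continuous (lerayVorticity V s) :=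
    (signedBudget_contDiff_lerayVorticity_slice hV s (n := 1)).continuous
  have hball : ∀ n : ℕ, 1 ≤ (n : ℝ) →
      (∫ y in closedBall (0 : EuclideanSpace ℝ (Fin 3)) n, ‖lerayVorticity V s y‖ ^ 2) ≤
        ((a + b) * m + L / n * M) / (1 / 2) := by
    intro n hn
    have hR : 0 < (n : ℝ) := lt_of_lt_of_le one_pos hn
    refine le_trans ?_ (hZ n hn s)
    have hint : Integrable fun y => smoothTransition (2 - ‖y‖ ^ 2 / (n : ℝ) ^ 2) ^ 2 *
        ‖lerayVorticity V s y‖ ^ 2 :=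
      (((contDiff_sqCutoff (n := 1) (n : ℝ)).continuous).mul (hcΩ.norm.pow 2)).integrable_of_hasCompactSupport
        ((hasCompactSupport_sqCutoff hR).mul_right)
    calc (∫ y in closedBall (0 : EuclideanSpace ℝ (Fin 3)) n, ‖lerayVorticity V s y‖ ^ 2)
        = ∫ y in closedBall (0 : EuclideanSpace ℝ (Fin 3)) n,
            smoothTransition (2 - ‖y‖ ^ 2 / (n : ℝ) ^ 2) ^ 2 * ‖lerayVorticity V s y‖ ^ 2 := by
          refine setIntegral_congr_fun measurableSet_closedBall fun y hy => ?_
          rw [mem_closedBall, dist_zero_right] at hy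
          rw [sqCutoff_eq_one hR hy, one_mul]
      _ ≤ ∫ y, smoothTransition (2 - ‖y‖ ^ 2 / (n : ℝ) ^ 2) ^ 2 * ‖lerayVorticity V s y‖ ^ 2 :=
          setIntegral_le_integral hint (Eventually.of_forall fun y =>
            mul_nonneg (sq_nonneg _) (sq_nonneg _))
  have hlim : Tendsto (fun n : ℕ =>
      ∫ y in closedBall (0 : EuclideanSpace ℝ (Fin 3)) n, ‖lerayVorticity V s y‖ ^ 2) atTop
      (𝓝 (∫ y, ‖lerayVorticity V s y‖ ^ 2)) := by
    have h := tendsto_setIntegral_of_monotone (μ := (volume : Measure (EuclideanSpace ℝ (Fin 3))))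
      (s := fun n : ℕ => closedBall (0 : EuclideanSpace ℝ (Fin 3)) n)
      (f := fun y => ‖lerayVorticity V s y‖ ^ 2) (fun n => measurableSet_closedBall)
      (fun m n hmn => closedBall_subset_closedBall (by exact_mod_cast hmn))
      (by rw [iUnion_closedBall_nat]; exact (hΩi s).1.integrableOn)
    rwa [iUnion_closedBall_nat, Measure.restrict_univ] at h
  have hlim0 : Tendsto (fun n : ℕ => ((a + b) * m + L / n * M) / (1 / 2)) atTop
      (𝓝 (((a + b) * m + 0 * M) / (1 / 2))) :=
    (((tendsto_const_div_atTop_nhds_zero_nat L).mul_const M).const_add _).div_const _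
  have hE := le_of_tendsto_of_tendsto hlim hlim0 (Filter.eventually_atTop.2 ⟨1, fun n hn => hball n
      (by exact_mod_cast hn)⟩)
  have e : ((a + b) * m + 0 * M) / (1 / 2) = 2 * (a + b) * m := by ring
  rwa [e] at hE

end Budget

end Summit.NavierStokesRegularity.NavierStokesRegularity.Theorems.FiniteDissipationLiouville.VorticityAmplitude

end
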